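import Summits.QuantumFields.BalabanUV.Beta.GAN24.WoodburyFibreZeroModeOsc
import Summits.QuantumFields.BalabanUV.Beta.GAN24.WoodburyFibreZeroModeGainStep

/-!
# GAN24 / WoodburyFibreZeroModeGainEnd — TURN-KEY forms of the zero-mode gain: a forward-difference bound `ε` on a leg of a composition
# through a block-annihilating kernel enters the `Decays` constant LINEARLY (`(d+2)(Lc−1)·ε` per soft leg; `ε_A·ε_B` two-sided)
# (census row V14 of `HOME/b2b-balaban-gan24-p3/WOODBURY-FIBRE.md` v8, END of the four-file chain `WoodburyFibreZeroModeGain` →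
# `…GainKInv` → `…GainStep`, `…Osc`; binder row G-an2-4 ∕ (CONV-C), P3, gen 8)

Cell `pub-balaban`, β sub-cell.  HONEST FRAMING (verbatim): discharging `BetaPertH` makes Bałaban's UV stability UNCONDITIONAL — a real
constructive-QFT result; it is NOT the continuum limit and NOT the Clay problem.  HONEST DEPENDENCY (verbatim): continuum YM on T⁴ ⇐
BetaPertH ∧ nine spine estimates (0/9 proved); BetaPertH ⇐ (D1) ∧ (D4) ∧ CAP+tail; G-an2-4 gates asym, D1 and NE2/3/4.  NOT IN PRINT; OUR
BOOKKEEPING.  [folklore] compositions BY NAME of the three companion files; cites nothing, mints no `def … : Prop`, instantiates no wall binder;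
every `Decays` ∕ forward-difference datum is a HYPOTHESIS.  Discharges NOTHING of (CONV-C), the W-slot (hW, hWall), «T2Shape», (D1); NEVER
«G-an2-4 closed»; NOT BetaPertH, NOT continuum, NOT Clay.

## What is proved (all [folklore]; `Γ_j^{ff} := blockFF (KInvStep Lc j)` on the step-`j` lattice `ℤ^{d+1}`, fibre `Fib d`)
* **`decays_comp_ffKInvStep_of_fwdDiff`**: `Decays Γ_j^{ff} C_Γ δ` (`δ > 0`), `Decays J C_J δ`, `|J(y + e_μ, z)_{fb} − J(y, z)_{fb}| ≤ ε·e^{−δ|y−z|₁}`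
  ⇒ `Decays (Γ_j^{ff} ∘ J) (|Fib d|·(C_Γ·ω(ε))·Zl_{d+1}(δ − δ′)) δ′`, `ω(ε) = (d+2)(Lc−1)·ε·e^{2δ(d+2)(Lc−1)}` — for every `j`, `0 ≤ δ′ < δ`;
  **`decays_comp_ffKInvStep_of_fwdDiff_left`** (forward differences in the second variable of the left leg);
  **`decays_comp_comp_ffKInvStep_of_fwdDiff`**: both legs soft ⇒ constant `|Fib d|²·ω(ε_A)·C_Γ·ω(ε_B)·Zl(δ−δ′)·Zl(δ′−δ″)`.
* The SCALAR-BLOCK analogue for any kernel with zero block sums (any dimension `D`, any finite fibre): **`decays_comp_of_blockSum_of_fwdDiff`**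
  (`ω(ε) = D(N−1)·ε·e^{2δD(N−1)}`) and its left twin.
READING (context only, asserted nowhere): with `ε ~ Lc^{−(n−m)}` for a leg that is a composite (level-`n`) object read on the level-`m`
lattice, the one-sided constant carries `Lc^{−(n−m)}` and the two-sided one `Lc^{−2(n−m)}` — the shape asked for class (c) of the W∕T₂-slot
planning note (journal 2026-08-20 l.6956); whether the W-slot's legs obey such forward-difference bounds is NOT addressed here.
-/

noncomputable section

open Finset
open scoped BigOperators
open Literature.MathematicalPhysics.QuantumFieldTheory
open Literature.MathematicalPhysics.QuantumFieldTheory.Balaban1983to89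
open Literature.MathematicalPhysics.QuantumFieldTheory.Balaban1983to89.Beta
open B12Sec2to5 (l1 l1_nonneg)
open ExpKernelCalculus (MKer Decays comp Zl)
open KernelWard (Bdd bdd_of_decays)
open AffineAveraging (unitVec blockSum)
open OneStepResolventKernel (Fib)
open OneStepKernelFamily (KInvStep)
open Summit.QuantumFields.BalabanUV.Beta.GAN24.WoodburyFibreBlocks (blockFF)
open Summit.QuantumFields.BalabanUV.Beta.GAN24.WoodburyFibreZeroModeGain
open Summit.QuantumFields.BalabanUV.Beta.GAN24.WoodburyFibreZeroModeOsc
open Summit.QuantumFields.BalabanUV.Beta.GAN24.WoodburyFibreZeroModeGainStep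

namespace Summit.QuantumFields.BalabanUV.Beta.GAN24.WoodburyFibreZeroModeGainEnd

/-! ## §1 Bałaban's decimated one-step resolvent, field–field block -/

section Step

variable {d : ℕ} {Lc : ℕ} [NeZero Lc]

/-- The oscillation constant `ω(ε) = (d+2)(Lc−1)·ε·e^{2δ(d+2)(Lc−1)}` is nonnegative. [folklore] -/
theorem osc_const_nonneg {ε δ : ℝ} (hε : 0 ≤ ε) :
    0 ≤ (((d : ℝ) + 2) * ((Lc : ℝ) - 1)) * ε * Real.exp (2 * δ * (((d : ℝ) + 2) * ((Lc : ℝ) - 1))) := by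
  have hN1 : (0 : ℝ) ≤ (Lc : ℝ) - 1 := by
    have : (1 : ℝ) ≤ Lc := by exact_mod_cast Nat.pos_of_ne_zero (NeZero.ne Lc)
    linarith
  positivity

/-- **TURN-KEY ONE-SIDED GAIN (right leg)**: a forward-difference bound `ε` on the first variable of the right leg `J` enters the `Decays`
constant of `Γ_j^{ff} ∘ J` linearly, for every `j`. [folklore] -/
theorem decays_comp_ffKInvStep_of_fwdDiff (j : ℕ) {J : MKer (d + 1) (Fib d)} {CΓ CJ ε δ δ' : ℝ}
    (hΓ : Decays (blockFF (KInvStep (d := d) Lc j)) CΓ δ) (hδ : 0 < δ) (hJ : Decays J CJ δ) (hε : 0 ≤ ε)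
    (hD : ∀ μ y z f b, |J (y + unitVec μ) z f b - J y z f b| ≤ ε * Real.exp (-δ * l1 (y - z))) (hδ'0 : 0 ≤ δ') (hδ' : δ' < δ) :
    Decays (comp (blockFF (KInvStep (d := d) Lc j)) J)
      ((Fintype.card (Fib d) : ℝ) *
        (CΓ * ((((d : ℝ) + 2) * ((Lc : ℝ) - 1)) * ε * Real.exp (2 * δ * (((d : ℝ) + 2) * ((Lc : ℝ) - 1))))) *
          Zl (d + 1) (δ - δ')) δ' :=
  decays_comp_ffKInvStep_right j hΓ hδ (bdd_of_decays hJ hδ.le) (decays_sub_contourRef (N := Lc) hε hδ.le hD) hδ'0 hδ'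

/-- **TURN-KEY ONE-SIDED GAIN (left leg)**: a forward-difference bound `ε` on the second variable of the left leg `A`. [folklore] -/
theorem decays_comp_ffKInvStep_of_fwdDiff_left (j : ℕ) {A : MKer (d + 1) (Fib d)} {CΓ CA ε δ δ' : ℝ} (hA : Decays A CA δ)
    (hΓ : Decays (blockFF (KInvStep (d := d) Lc j)) CΓ δ) (hδ : 0 < δ) (hε : 0 ≤ ε)
    (hD : ∀ μ x y a f, |A x (y + unitVec μ) a f - A x y a f| ≤ ε * Real.exp (-δ * l1 (x - y))) (hδ'0 : 0 ≤ δ') (hδ' : δ' < δ) :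
    Decays (comp A (blockFF (KInvStep (d := d) Lc j)))
      ((Fintype.card (Fib d) : ℝ) *
        (((((d : ℝ) + 2) * ((Lc : ℝ) - 1)) * ε * Real.exp (2 * δ * (((d : ℝ) + 2) * ((Lc : ℝ) - 1)))) * CΓ) *
          Zl (d + 1) (δ - δ')) δ' :=
  decays_comp_ffKInvStep_left j (bdd_of_decays hA hδ.le) hΓ hδ (decays_sub_contourRefL (N := Lc) hε hδ.le hD) hδ'0 hδ'

/-- **TURN-KEY TWO-SIDED GAIN**: forward-difference bounds `ε_A` (second variable of `A`) and `ε_B` (first variable of `B`) BOTH enter the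
constant of `A ∘ Γ_j^{ff} ∘ B`. [folklore] -/
theorem decays_comp_comp_ffKInvStep_of_fwdDiff (j : ℕ) {A B : MKer (d + 1) (Fib d)} {CA CΓ CB εA εB δ δ' δ'' : ℝ}
    (hA : Decays A CA δ) (hΓ : Decays (blockFF (KInvStep (d := d) Lc j)) CΓ δ) (hB : Decays B CB δ) (hCB : 0 ≤ CB) (hδ : 0 < δ)
    (hεA : 0 ≤ εA) (hεB : 0 ≤ εB)
    (hDA : ∀ μ x y a f, |A x (y + unitVec μ) a f - A x y a f| ≤ εA * Real.exp (-δ * l1 (x - y)))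
    (hDB : ∀ μ y z f b, |B (y + unitVec μ) z f b - B y z f b| ≤ εB * Real.exp (-δ * l1 (y - z)))
    (hδ'0 : 0 < δ') (hδ' : δ' < δ) (hδ''0 : 0 ≤ δ'') (hδ'' : δ'' < δ') :
    Decays (comp (comp A (blockFF (KInvStep (d := d) Lc j))) B)
      ((Fintype.card (Fib d) : ℝ) *
        (((Fintype.card (Fib d) : ℝ) *
            (((((d : ℝ) + 2) * ((Lc : ℝ) - 1)) * εA * Real.exp (2 * δ * (((d : ℝ) + 2) * ((Lc : ℝ) - 1)))) * CΓ) *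
              Zl (d + 1) (δ - δ')) *
          ((((d : ℝ) + 2) * ((Lc : ℝ) - 1)) * εB * Real.exp (2 * δ * (((d : ℝ) + 2) * ((Lc : ℝ) - 1))))) *
        Zl (d + 1) (δ' - δ'')) δ'' :=
  decays_comp_comp_ffKInvStep j hA hΓ hB hCB hδ (decays_sub_contourRefL (N := Lc) hεA hδ.le hDA)
    (decays_sub_contourRef (N := Lc) hεB hδ.le hDB) (osc_const_nonneg hεB) hδ'0 hδ' hδ''0 hδ''

end Step

/-! ## §2 The scalar-block analogue (any dimension, any finite fibre) -/

section Scalar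

variable {D : ℕ} {F : Type*} [Fintype F] {N : ℕ} [NeZero N]

/-- **TURN-KEY SCALAR GAIN (right leg)**: zero block sums of the rows of `Γ` + a forward-difference bound `ε` on the right leg ⇒
`Decays (Γ ∘ J) (|F|·C_Γ·D(N−1)·ε·e^{2δD(N−1)}·Zl_D(δ−δ′)) δ′`. [folklore] -/
theorem decays_comp_of_blockSum_of_fwdDiff {Γ J : MKer D F} {CΓ CJ ε δ δ' : ℝ} (hΓ : Decays Γ CΓ δ) (hδ : 0 < δ)
    (hZ : ∀ x a f u, blockSum N (fun y => Γ x y a f) u = 0) (hJ : Decays J CJ δ) (hε : 0 ≤ ε)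
    (hD : ∀ μ y z f b, |J (y + unitVec μ) z f b - J y z f b| ≤ ε * Real.exp (-δ * l1 (y - z))) (hδ'0 : 0 ≤ δ') (hδ' : δ' < δ) :
    Decays (comp Γ J)
      ((Fintype.card F : ℝ) * (CΓ * ((D * ((N : ℝ) - 1)) * ε * Real.exp (2 * δ * (D * ((N : ℝ) - 1))))) * Zl D (δ - δ')) δ' :=
  decays_comp_of_blockSum_eq_zero hΓ hδ (bdd_of_decays hJ hδ.le) hZ (decays_sub_blockRef (N := N) hε hδ.le hD) hδ'0 hδ'

/-- **TURN-KEY SCALAR GAIN (left leg)**: zero block sums of the columns of `Γ` + a forward-difference bound on the left leg. [folklore] -/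
theorem decays_comp_of_blockSum_of_fwdDiff_left {A Γ : MKer D F} {CΓ CA ε δ δ' : ℝ} (hA : Decays A CA δ) (hΓ : Decays Γ CΓ δ)
    (hδ : 0 < δ) (hZ : ∀ z f b u, blockSum N (fun y => Γ y z f b) u = 0) (hε : 0 ≤ ε)
    (hD : ∀ μ x y a f, |A x (y + unitVec μ) a f - A x y a f| ≤ ε * Real.exp (-δ * l1 (x - y))) (hδ'0 : 0 ≤ δ') (hδ' : δ' < δ) :
    Decays (comp A Γ)
      ((Fintype.card F : ℝ) * (((D * ((N : ℝ) - 1)) * ε * Real.exp (2 * δ * (D * ((N : ℝ) - 1)))) * CΓ) * Zl D (δ - δ')) δ' :=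
  decays_comp_of_blockSum_eq_zero_left (bdd_of_decays hA hδ.le) hΓ hδ hZ (decays_sub_blockRefL (N := N) hε hδ.le hD) hδ'0 hδ'

end Scalar

end Summit.QuantumFields.BalabanUV.Beta.GAN24.WoodburyFibreZeroModeGainEnd

end
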